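import Literature.MathematicalPhysics.QuantumFieldTheory.Balaban1983to89.B15Ineq131Input
import Literature.MathematicalPhysics.QuantumFieldTheory.Balaban1983to89.B14Ineq38Proof

/-!
# `Balaban1983to89.B14Ineq38From190` — T. Bałaban, *Convergent renormalization expansions for lattice gauge theories*,
# Commun. Math. Phys. **119** (1988) 243–285 [Balaban1988Convergent] = [III], (3.7) p. 266: the FIRST MEMBER
# *"|𝐇_{k,□}|, |∇^η_{U_{k+1,□′}}𝐇_{k,□}| ≦ B₃(4δ_k + exp(−δ2M₂R_k)30d²L²B₃(1+β₀)ε_k)"* DERIVED from the exponential decay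
# property (190) of [15] = [Balaban1985Variational] (TWO localised pieces of the argument field), r11's printed chain
# `B14Sect3.Ineq37Printed` with its hypothesis `hfirst` DISCHARGED and the clause *"for A₁/A₀ and γ sufficiently small"*
# EXPLICIT; and (3.8) p. 266 END-TO-END on p29's lattice model (`B14Ineq38Proof.ineq38_lt` with its six `𝐇`-inputs derived)

statement-level skeleton of published theorems with citation tags; proofs where landed; nothing here is a claim
about the Yang–Mills mass gap

CITATION HEADER (lean-in-tree rule 2026-08-18).  T. Bałaban, *Convergent renormalization expansions for lattice gauge
theories*, Commun. Math. Phys. **119**, 243–285 (1988), doi:10.1007/BF01217741, bib `Balaban1988Convergent` (cell paper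
B14 = "[III]").  PDF held: `paper:balaban1988-cmp119-convergent-renormalization` (journal page = PDF page + 242), p. 266
[PDF 24] READ AS AN IMAGE on the x2 render
`run/shared/lean/pub/pub-balaban/b2b-balaban-ref1/pages/1988-cmp119-convergent-renormalization/…-p024-x2.png` (this seat,
2026-08-21).  "[15]" = T. Bałaban, CMP **102** (1985) 277–309 [Balaban1985Variational], (190) p. 308 (tree: the
block-majorant form `B11SectG.Ineq190 bB bout dH C δ₀`); "[3]" of [15] = [Balaban1984PropagatorsII] (2.61) p. 234 (tree:
`B11SectG.RowSum`); "[14]" = [Balaban1985RegularSpaces] ((1.65), (1.43)).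

WHAT IS REPRODUCED.  SKELETON row **B14.Claim@265** (§3 pp. 265–266, (3.6)–(3.9); rows of record
`lit-balaban-r11/ROWS-B14.md`: "(3.7), (3.8) as Props + arithmetic PROVED … (3.8) first member PROVED p253289 … (3.7)'s located
bound itself ([14] (1.65), [15] (190)) remains the typed hypothesis"), mega-formalization `lit-balaban`, HOME
`run/shared/lean/pub/lit-balaban/`, unit `lit-balaban-r11` gen 7 (reader/typer and fold owner of block B14).  KNITTING —
used BY NAME, nothing restated: r12's `B15HDecayLeaves.loc_le_one_piece` (pv12's *"additional exponential factor"* lemma at a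
single block), r12's `B15GammaSmallness.exp_neg_R_le_gamma_sq` (`e^{−R_j} ≤ γ²` from (2.5)), r11's (b2b-balaban-pv02's)
`B14Sect3.ineq37_conclusion` / `ineq37Printed_of_first` (the scalar chain (3.7)), p29's `B14Ineq38Proof.ineq38_lt` ((3.8) on
the `ℤ^d` lattice carriers from its first member).  Pattern = r12's `B15Ineq131Input` + `B15Ineq131From190` ([IV] (1.31),
whose `ℍ`-input is the one-piece analogue: there the argument field VANISHES off the boundary layer; here it is `≤ 4δ_k`
in the bulk and `≤ 30d²L²B₃(1+β₀)ε_k` on the layer — two pieces).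

THE PRINTED TEXT (p. 266, verbatim from the render): *"□⊂□′⊂Ω~_{k+1}. For the function U_{k,□} we have U_{k,□} =
U(𝐁_k(□^{~4}), [M˙(Q_k^{s*}V_k)(M˙(U_{k+1,□′}))⁻¹]M˙(U_{k+1,□′})) = (exp iη𝐇_{k,□}((1/i) log[M˙(Q_k^{s*}V_k)(M˙(U_{k+1,□′}))⁻¹])
U_{k+1,□′})^{u⁻¹_{k,□}}. (3.6)  On almost the whole cube □^{~4}, except a boundary layer of the width 2M₁, the field in
the argument of the function 𝐇_{k,□} is equal to (1/i) log[V_k(V^{(k)}_{□′})⁻¹], hence it can be bounded by 4δ_k. On the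
boundary layer this field can be bounded by 30d²L²B₃(1+β₀)ε_k by an application of the inequality (1.65) from [14], or
rather by an application of the reasoning leading to that inequality. By the exponential decay property (190) [15] we
obtain the estimate  |𝐇_{k,□}|, |∇^η_{U_{k+1,□′}}𝐇_{k,□}| ≦ B₃(4δ_k + exp(−δ2M₂R_k)30d²L²B₃(1+β₀)ε_k)
< (4B₃A₁/A₀ + 30d²L²B₃²(1+β₀)exp(−R_k))ε_k < (1/10)ε_k on □~, (3.7)  for A₁/A₀ and γ sufficiently small. This estimate
and the equalities (3.7), (1.43) [14] imply  |U_{k,□}(∂p) − 1| < (1 + (2/10)ε_kη)ε_{k+1}(L⁻¹η)² + (2/10)ε_kη²(1 + (4/10)ε_k)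
< 2(1+β₀)L⁻²ε_kη² + (4/10)ε_kη² < ε_kη² for p⊂□~. (3.8)  Thus χ_k(□) = 1 for □⊂Ω~_{k+1}."*  [15] (190) p. 308:
*"|(δ/δB_ν(y′))𝓗_μ(B,x)|, |∇_x(δ/δB_ν(y′))𝓗_μ(B,x)|, … ≤ O(1)[(L^jη)^{−1}, (L^jη)^{−2}, …]·(L^{j′}η)^{−d} exp(−⅛δ₀d(y,y′))"*.

WHAT THIS FILE PROVES (kernel-checked, zero `sorry`; no `def`, no new `Prop`, no new named fact; axioms standard).
Over the block-majorant vocabulary of `B11SectG` (`g : B6.Geometry` = the multiscale set with its distance `d`, `bB` = the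
B-size of the argument field, `bout` = a local size of the values — for (3.7) the two sizes `sup|𝐇_{k,□}|` (`bout₀`) and
`sup|∇^η_{U_{k+1,□′}}𝐇_{k,□}|` (`bout₁`)):
* §1 `loc_le_two_pieces`, `loc_le_two_pieces_of_meanValue` — for a linear `dH` with (190) (constant `C`), the row sum (2.61)
  at rate `σ`, any rate `τ ≥ 0` with `σ + τ ≤ ⅛δ₀`, and an argument `B = B₁ + B₂` whose pieces have B-sizes `≤ mᵢ` and
  vanish on the blocks `y′` with `d(y, y′) < Dᵢ`: `bout.loc y (dH B) ≤ Cκ_Bc·(m₁e^{−τD₁} + m₂e^{−τD₂})`; the same for the VALUE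
  `𝐇(B)` when every base-point derivative `dH t` satisfies (190) and `𝐇(B)` is dominated by the common bounds of the `dH t B`
  (`hmv`, the mean-value reading of Prop. 9 of [15], as in `B15HDecayLeaves`).
* §2 **(3.7), FIRST MEMBER FROM (190)** `boundH37_of_ineq190`: with the bulk piece `B₁` of B-size `≤ 4δ_k` (*"equal to
  (1/i)log[V_k(V^{(k)}_{□′})⁻¹], hence … bounded by 4δ_k"*; distance `≥ 0`) and the layer piece `B₂` of B-size
  `≤ 30d²L²B₃(1+β₀)ε_k` vanishing on the blocks closer than `D` to `y` (the `2M₁`-layer at `∂□^{~4}` seen from `□~`) with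
  `δ2M₂R_k ≤ τD`, and `Cκ_Bc ≤ B₃`: `bout.loc y 𝐇B ≤ B₃(4δ_k + e^{−δ2M₂R_k}30d²L²B₃(1+β₀)ε_k)` — EXACTLY the first member of
  r11's `B14Sect3.Ineq37Printed` (its hypothesis `hfirst`).  **THE WHOLE CHAIN** `ineq37Printed_of_ineq190` (⊢
  `B14Sect3.Ineq37Printed …` under r11's strict side conditions) and **THE CONCLUSION USED** `ineq37_lt_of_ineq190`
  (`bout.loc y 𝐇B < (1/10)ε_k` under r11's `δ_k = (A₁/A₀)ε_k`, `2δM₂ ≥ 1`, `R_k ≥ 0` and the restriction `h10`: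
  `4B₃A₁/A₀ + 30d²L²B₃²(1+β₀)e^{−R_k} < 1/10`).  **«for A₁/A₀ and γ sufficiently small» EXPLICIT** `h10_of_gamma`: `h10` from
  (2.5) for `R_k` (`B14.IsRj`, `r ≥ 1`), `0 < g_k ≤ γ`, `log γ⁻² ≥ 1` (`e^{−R_k} ≤ γ²`, r12) and the clause
  `4B₃A₁/A₀ + 30d²L²B₃²(1+β₀)γ² < 1/10`; whence `ineq37_lt_of_ineq190_gamma`.
* §3 **(3.8) END-TO-END ON THE LATTICE MODEL** `ineq38_lt_lattice_of_ineq190` — for p29's lattice expression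
  `U_{k,□} = (e^{iη𝐇}U_{k+1,□′})^{u⁻¹}` ((3.6)) at the plaquette `p = (x; μ, ν)`: `|U_{k,□}(∂p) − 1| < ε_kη²` (*"Thus χ_k(□) =
  1"*), with the six `𝐇`-inputs of `B14Ineq38Proof.ineq38_lt` (the function at the four bonds of `∂p`, the two covariant
  derivatives at `x`) NOT assumed but DERIVED from (190) for the two sizes `bout₀`, `bout₁` at the base point `y` through
  `ineq37_lt_of_ineq190` and the DICTIONARY hypotheses (`hdom₁…₄`: `bout₀.loc y 𝐇B` dominates `|𝐇|` at the four bonds;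
  `hdomD₁,₂`: `bout₁.loc y 𝐇B` dominates the two covariant derivatives); p29's located inputs verbatim (`0 < η ≤ 1`,
  `0 < ε_k ≤ 1`, `L > 0`, `0 < ε_{k+1} ≤ (1+β₀)ε_k` ((2.8)), `2(1+β₀)L⁻² + 4/10 < 1`, the (3.2)-restriction
  `|U_{k+1,□′}(∂p) − 1| < ε_{k+1}(L⁻¹η)²`); `ineq38_lt_lattice_of_ineq190_gamma` — the same with `h10` from γ.
HONEST SCOPE.  (190) itself ((2.61), the identification of print's sups with the local sizes `bout₀`/`bout₁`), the B-size
bounds `4δ_k` / `30d²L²B₃(1+β₀)ε_k` of the two pieces (consequences of (3.3) and of *"the reasoning leading to (1.65) [14]"* —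
a cited METHOD, cell GAPS.md G-B14s-05; the located objection C-adv5-92 (b) on the coefficient `4` is r11's `B14Sect3`
revision-v4 note and is untouched here: `boundH37_of_ineq190` takes the bulk bound `4δ_k` as the hypothesis `hm₁`) and their
localisation distance `D` with `δ2M₂R_k ≤ τD` are HYPOTHESES in the printed shapes; the mean-value domination `hmv` is the
declared reading of how Prop. 9's derivative bound controls `𝓗(B)` (as in `B15HDecayLeaves`); the lattice model of §3 is
p29's ((M1)–(M8) of `B14Ineq38Proof`).  Value = the (3.7) leaf of row B14.Claim@265 reduced to ONE typed published
inequality ((190)) plus located data, and (3.8) with no `𝐇`-hypothesis left, kernel-checked; NOT summit progress.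
VERSIONS.  v1 = p262722 (commit 552476aa734f; §§1–3 above, r11 gen 7).  v1.1 (this file, r11 gen 95) is APPEND-ONLY: the new
§4 *"(2.8) BY NAME"* adds `ineq38_lt_lattice_of_ineq190_gamma_byname`, in which the one-step flow letter
`hflow : ε_{k+1} ≤ (1+β₀)ε_k` of §3 is DERIVED from r11's typed (2.8) `B14.FlowIneq28 ε g β′ β₀ K` (`B14.lean`, row B14.Eq2.8)
at the step `k → k+1 ≤ K` — (3.8) p. 266 *"… < 2(1+β₀)L⁻²ε_kη² + …"* uses (2.8) exactly at that step —, (2.5) being taken by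
name already (`hRj : B14.IsRj`).  No v1 declaration, statement or proof is changed.
-/

open NormedSpace Finset Complex

namespace Literature.MathematicalPhysics.QuantumFieldTheory.Balaban1983to89.B14Ineq38From190

open Literature.MathematicalPhysics.QuantumFieldTheory.Balaban1983to89
open B11SectG B7Prop1Explicit B15HDecayLeaves B15GammaSmallness B14Ineq38Proof

variable {g : B6.Geometry} {FB FA : Type} [AddCommGroup FB] [Module ℝ FB] [AddCommGroup FA] [Module ℝ FA]

/-! ## §1 Two localised pieces (linear level, and the value `𝐇(B)` through the base-point derivatives) -/

/-- **Two localised pieces** (the shape of (3.7)₁): `B = B₁ + B₂`, B-sizes `≤ mᵢ`, piece `i` vanishing on the blocks `y′`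
with `d(y, y′) < Dᵢ` ⇒ `bout.loc y (dH B) ≤ Cκ_Bc·(m₁e^{−τD₁} + m₂e^{−τD₂})` (pv12's one-piece lemma twice, r12's
`B15HDecayLeaves.loc_le_one_piece`, and subadditivity of the size).
[cite: Balaban1988Convergent, (3.7) p.266; Balaban1985Variational, (190) p.308] -/
theorem loc_le_two_pieces {bB : BlockNorm g FB} {bout : BlockNorm g FA} {dH : FB →ₗ[ℝ] FA} {C δ₀ σ τ c : ℝ}
    (h190 : Ineq190 bB bout dH C δ₀) (hC : 0 ≤ C) (hd : ∀ a b : g.Site, 0 ≤ g.dist a b) (hrow : RowSum g σ c)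
    (hτ : 0 ≤ τ) (hστ : σ + τ ≤ δ₀ / 8) {B₁ B₂ : FB} {m₁ m₂ D₁ D₂ : ℝ} (y : g.Site)
    (hm₁ : ∀ y', bB.loc y' B₁ ≤ m₁) (hD₁ : ∀ y', bB.loc y' B₁ ≠ 0 → D₁ ≤ g.dist y y')
    (hm₂ : ∀ y', bB.loc y' B₂ ≤ m₂) (hD₂ : ∀ y', bB.loc y' B₂ ≠ 0 → D₂ ≤ g.dist y y') :
    bout.loc y (dH (B₁ + B₂)) ≤ C * bB.κ * c * (m₁ * Real.exp (-(τ * D₁)) + m₂ * Real.exp (-(τ * D₂))) := by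
  have h₁ := loc_le_one_piece h190 hC hd hrow hτ hστ B₁ hm₁ y hD₁
  have h₂ := loc_le_one_piece h190 hC hd hrow hτ hστ B₂ hm₂ y hD₂
  rw [map_add]
  have hsub := bout.loc_add_le y (dH B₁) (dH B₂)
  have hring : C * bB.κ * c * (m₁ * Real.exp (-(τ * D₁)) + m₂ * Real.exp (-(τ * D₂)))
      = C * bB.κ * c * m₁ * Real.exp (-(τ * D₁)) + C * bB.κ * c * m₂ * Real.exp (-(τ * D₂)) := by ring
  linarith

/-- **Two pieces for the value `𝐇(B)`**: if every base-point derivative `dH t` satisfies (190) with the constants `C, δ₀`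
and `𝐇B` is dominated by the common bounds of the `dH t (B₁ + B₂)` (`hmv`, the mean-value reading of Prop. 9 of [15]),
the two-piece bound holds for `bout.loc y 𝐇B`. [cite: Balaban1985Variational, Prop. 9 (190) p.309] -/
theorem loc_le_two_pieces_of_meanValue {T : Type*} {bB : BlockNorm g FB} {bout : BlockNorm g FA}
    {dH : T → FB →ₗ[ℝ] FA} {C δ₀ σ τ c : ℝ} (h190 : ∀ t, Ineq190 bB bout (dH t) C δ₀) (hC : 0 ≤ C)
    (hd : ∀ a b : g.Site, 0 ≤ g.dist a b) (hrow : RowSum g σ c) (hτ : 0 ≤ τ) (hστ : σ + τ ≤ δ₀ / 8)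
    {B₁ B₂ : FB} {m₁ m₂ D₁ D₂ : ℝ} (y : g.Site)
    (hm₁ : ∀ y', bB.loc y' B₁ ≤ m₁) (hD₁ : ∀ y', bB.loc y' B₁ ≠ 0 → D₁ ≤ g.dist y y')
    (hm₂ : ∀ y', bB.loc y' B₂ ≤ m₂) (hD₂ : ∀ y', bB.loc y' B₂ ≠ 0 → D₂ ≤ g.dist y y')
    {HB : FA} (hmv : ∀ s : ℝ, (∀ t, bout.loc y (dH t (B₁ + B₂)) ≤ s) → bout.loc y HB ≤ s) :
    bout.loc y HB ≤ C * bB.κ * c * (m₁ * Real.exp (-(τ * D₁)) + m₂ * Real.exp (-(τ * D₂))) :=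
  hmv _ fun t => loc_le_two_pieces (h190 t) hC hd hrow hτ hστ y hm₁ hD₁ hm₂ hD₂

/-! ## §2 [III] (3.7): the first member from (190), the printed chain, the conclusion, and the γ-clause -/

/-- **(3.7), FIRST MEMBER, p. 266 FROM (190)**: *"|𝐇_{k,□}|, |∇^η_{U_{k+1,□′}}𝐇_{k,□}| ≦ B₃(4δ_k +
exp(−δ2M₂R_k)30d²L²B₃(1+β₀)ε_k)"* for any local size `bout` of `𝐇_{k,□}` (the function or its covariant derivative,
weights inside) from: (190) at every base point, (2.61) at rate `σ`, `τ ≥ 0` with `σ + τ ≤ ⅛δ₀`, the argument field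
`B = B₁ + B₂` with the BULK piece of B-size `≤ 4δ_k` (*"equal to (1/i)log[V_k(V^{(k)}_{□′})⁻¹], hence it can be bounded by
4δ_k"*) and the LAYER piece of B-size `≤ 30d²L²B₃(1+β₀)ε_k` (*"On the boundary layer this field can be bounded by
30d²L²B₃(1+β₀)ε_k"*) vanishing on the blocks `y′` with `d(y, y′) < D`, the geometry `δ2M₂R_k ≤ τD` (the `2M₁`-layer at
`∂□^{~4}` seen from `□~`), `Cκ_Bc ≤ B₃`, and the mean-value domination.  (`R = R_k`; the printed "δ2M₂R_k" is
`2·δ·M₂·R_k`, r11's typed reading.) [cite: Balaban1988Convergent, (3.7) p.266; Balaban1985Variational, (190) p.308] -/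
theorem boundH37_of_ineq190 {T : Type*} {bB : BlockNorm g FB} {bout : BlockNorm g FA}
    {dH : T → FB →ₗ[ℝ] FA} {C δ₀ σ τ c D B₃ δ M₂ R δk d L β₀ εk : ℝ}
    (h190 : ∀ t, Ineq190 bB bout (dH t) C δ₀) (hC : 0 ≤ C) (hd : ∀ a b : g.Site, 0 ≤ g.dist a b)
    (hrow : RowSum g σ c) (hτ : 0 ≤ τ) (hστ : σ + τ ≤ δ₀ / 8) {B₁ B₂ : FB} (y : g.Site)
    (hm₁ : ∀ y', bB.loc y' B₁ ≤ 4 * δk)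
    (hm₂ : ∀ y', bB.loc y' B₂ ≤ 30 * d ^ 2 * L ^ 2 * B₃ * (1 + β₀) * εk)
    (hD₂ : ∀ y', bB.loc y' B₂ ≠ 0 → D ≤ g.dist y y')
    {HB : FA} (hmv : ∀ s : ℝ, (∀ t, bout.loc y (dH t (B₁ + B₂)) ≤ s) → bout.loc y HB ≤ s)
    (hgeom : 2 * δ * M₂ * R ≤ τ * D) (hCB : C * bB.κ * c ≤ B₃) (hB₃ : 0 ≤ B₃) :
    bout.loc y HB ≤ B₃ * (4 * δk + Real.exp (-(2 * δ * M₂ * R)) * (30 * d ^ 2 * L ^ 2 * B₃ * (1 + β₀) * εk)) := by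
  have hD₁ : ∀ y', bB.loc y' B₁ ≠ 0 → (0 : ℝ) ≤ g.dist y y' := fun y' _ => hd y y'
  have h := loc_le_two_pieces_of_meanValue h190 hC hd hrow hτ hστ y hm₁ hD₁ hm₂ hD₂ hmv
  rw [mul_zero, neg_zero, Real.exp_zero, mul_one] at h
  have hδk : 0 ≤ 4 * δk := (bB.loc_nonneg y B₁).trans (hm₁ y)
  have hlay : 0 ≤ 30 * d ^ 2 * L ^ 2 * B₃ * (1 + β₀) * εk := (bB.loc_nonneg y B₂).trans (hm₂ y)
  have hexp : Real.exp (-(τ * D)) ≤ Real.exp (-(2 * δ * M₂ * R)) := Real.exp_le_exp.mpr (by linarith)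
  have hbr : 0 ≤ 4 * δk + 30 * d ^ 2 * L ^ 2 * B₃ * (1 + β₀) * εk * Real.exp (-(τ * D)) := by positivity
  have hmono : 4 * δk + 30 * d ^ 2 * L ^ 2 * B₃ * (1 + β₀) * εk * Real.exp (-(τ * D))
      ≤ 4 * δk + Real.exp (-(2 * δ * M₂ * R)) * (30 * d ^ 2 * L ^ 2 * B₃ * (1 + β₀) * εk) := by
    have := mul_le_mul_of_nonneg_left hexp hlay
    linarith
  calc bout.loc y HB ≤ C * bB.κ * c * (4 * δk + 30 * d ^ 2 * L ^ 2 * B₃ * (1 + β₀) * εk * Real.exp (-(τ * D))) := h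
    _ ≤ B₃ * (4 * δk + 30 * d ^ 2 * L ^ 2 * B₃ * (1 + β₀) * εk * Real.exp (-(τ * D))) :=
        mul_le_mul_of_nonneg_right hCB hbr
    _ ≤ B₃ * (4 * δk + Real.exp (-(2 * δ * M₂ * R)) * (30 * d ^ 2 * L ^ 2 * B₃ * (1 + β₀) * εk)) :=
        mul_le_mul_of_nonneg_left hmono hB₃

/-- **(3.7), THE WHOLE PRINTED CHAIN FROM (190)** — r11's `B14Sect3.Ineq37Printed (bout.loc y 𝐇B) B₃ δ_k δ M₂ R_k d L β₀ ε_k A₀ A₁`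
(all three members, both `<` strict) with its first member DISCHARGED by `boundH37_of_ineq190`; the other two by r11's
`ineq37Printed_of_first` under its side conditions verbatim (`δ_k = (A₁/A₀)ε_k` — p. 265 after (3.4) —, the strict forms
`2δM₂ > 1`, `R_k > 0`, `B₃, ε_k, d, L, 1+β₀ > 0`, and the restriction `h10` = *"for A₁/A₀ and γ sufficiently small"*, cell
SMALLNESS.md S-B14.17). [cite: Balaban1988Convergent, (3.7) p.266] -/
theorem ineq37Printed_of_ineq190 {T : Type*} {bB : BlockNorm g FB} {bout : BlockNorm g FA}
    {dH : T → FB →ₗ[ℝ] FA} {C δ₀ σ τ c D B₃ δ M₂ R δk d L β₀ εk A₀ A₁ : ℝ}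
    (h190 : ∀ t, Ineq190 bB bout (dH t) C δ₀) (hC : 0 ≤ C) (hd : ∀ a b : g.Site, 0 ≤ g.dist a b)
    (hrow : RowSum g σ c) (hτ : 0 ≤ τ) (hστ : σ + τ ≤ δ₀ / 8) {B₁ B₂ : FB} (y : g.Site)
    (hm₁ : ∀ y', bB.loc y' B₁ ≤ 4 * δk)
    (hm₂ : ∀ y', bB.loc y' B₂ ≤ 30 * d ^ 2 * L ^ 2 * B₃ * (1 + β₀) * εk)
    (hD₂ : ∀ y', bB.loc y' B₂ ≠ 0 → D ≤ g.dist y y')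
    {HB : FA} (hmv : ∀ s : ℝ, (∀ t, bout.loc y (dH t (B₁ + B₂)) ≤ s) → bout.loc y HB ≤ s)
    (hgeom : 2 * δ * M₂ * R ≤ τ * D) (hCB : C * bB.κ * c ≤ B₃)
    (hB₃ : 0 < B₃) (hε : 0 < εk) (hβ : 0 < 1 + β₀) (hdpos : 0 < d) (hL : 0 < L) (hδkε : δk = A₁ / A₀ * εk)
    (hM : 1 < 2 * δ * M₂) (hR : 0 < R)
    (h10 : 4 * B₃ * A₁ / A₀ + 30 * d ^ 2 * L ^ 2 * B₃ ^ 2 * (1 + β₀) * Real.exp (-R) < 1/10) :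
    B14Sect3.Ineq37Printed (bout.loc y HB) B₃ δk δ M₂ R d L β₀ εk A₀ A₁ :=
  B14Sect3.ineq37Printed_of_first _ B₃ A₀ A₁ δ M₂ R εk δk β₀ d L hB₃ hε hβ hdpos hL hδkε hM hR h10
    (boundH37_of_ineq190 h190 hC hd hrow hτ hστ y hm₁ hm₂ hD₂ hmv hgeom hCB hB₃.le)

/-- **(3.7), THE CONCLUSION USED, FROM (190)**: `bout.loc y 𝐇B < (1/10)ε_k` — the first member from `boundH37_of_ineq190`,
then r11's `B14Sect3.ineq37_conclusion` (`δ_k = (A₁/A₀)ε_k`, `2δM₂ ≥ 1`, `R_k ≥ 0`, `ε_k > 0`, `1 + β₀ ≥ 0`, and the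
restriction `h10`: `4B₃A₁/A₀ + 30d²L²B₃²(1+β₀)e^{−R_k} < 1/10`). [cite: Balaban1988Convergent, (3.7) p.266] -/
theorem ineq37_lt_of_ineq190 {T : Type*} {bB : BlockNorm g FB} {bout : BlockNorm g FA}
    {dH : T → FB →ₗ[ℝ] FA} {C δ₀ σ τ c D B₃ δ M₂ R δk d L β₀ εk A₀ A₁ : ℝ}
    (h190 : ∀ t, Ineq190 bB bout (dH t) C δ₀) (hC : 0 ≤ C) (hd : ∀ a b : g.Site, 0 ≤ g.dist a b)
    (hrow : RowSum g σ c) (hτ : 0 ≤ τ) (hστ : σ + τ ≤ δ₀ / 8) {B₁ B₂ : FB} (y : g.Site)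
    (hm₁ : ∀ y', bB.loc y' B₁ ≤ 4 * δk)
    (hm₂ : ∀ y', bB.loc y' B₂ ≤ 30 * d ^ 2 * L ^ 2 * B₃ * (1 + β₀) * εk)
    (hD₂ : ∀ y', bB.loc y' B₂ ≠ 0 → D ≤ g.dist y y')
    {HB : FA} (hmv : ∀ s : ℝ, (∀ t, bout.loc y (dH t (B₁ + B₂)) ≤ s) → bout.loc y HB ≤ s)
    (hgeom : 2 * δ * M₂ * R ≤ τ * D) (hCB : C * bB.κ * c ≤ B₃) (hB₃ : 0 ≤ B₃)
    (hε : 0 < εk) (hβ : 0 ≤ 1 + β₀) (hδkε : δk = A₁ / A₀ * εk) (hM : 1 ≤ 2 * δ * M₂) (hR : 0 ≤ R)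
    (h10 : 4 * B₃ * A₁ / A₀ + 30 * d ^ 2 * L ^ 2 * B₃ ^ 2 * (1 + β₀) * Real.exp (-R) < 1/10) :
    bout.loc y HB < (1/10) * εk :=
  B14Sect3.ineq37_conclusion _ B₃ A₀ A₁ δ M₂ R εk δk β₀ d L hB₃ hε hβ hδkε hM hR h10
    (boundH37_of_ineq190 h190 hC hd hrow hτ hστ y hm₁ hm₂ hD₂ hmv hgeom hCB hB₃)

/-- **«for A₁/A₀ and γ sufficiently small» made explicit** (p. 266): the restriction `h10` of the chain (3.7),
`4B₃A₁/A₀ + 30d²L²B₃²(1+β₀)e^{−R_k} < 1/10`, from (2.5) for `R_k` (`B14.IsRj`, `r ≥ 1`), `0 < g_k ≤ γ`, `log γ⁻² ≥ 1`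
(whence `e^{−R_k} ≤ γ²`, r12's `B15GammaSmallness.exp_neg_R_le_gamma_sq`), `1 + β₀ ≥ 0`, and the EXPLICIT clause
`4B₃A₁/A₀ + 30d²L²B₃²(1+β₀)γ² < 1/10` (small `A₁/A₀` for the first summand — `d`, `L`, `B₃`, `β₀` fixed before —, small `γ`
for the second). [cite: Balaban1988Convergent, (3.7) p.266, (2.5) p.255] -/
theorem h10_of_gamma {Lnat r R : ℕ} {γ gk B₃ A₀ A₁ d L β₀ : ℝ} (hr : 1 ≤ r) (hRj : B14.IsRj Lnat r gk R)
    (hg : 0 < gk) (hgγ : gk ≤ γ) (hγe : 1 ≤ Real.log (γ ^ 2)⁻¹) (hβ : 0 ≤ 1 + β₀)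
    (hγ : 4 * B₃ * A₁ / A₀ + 30 * d ^ 2 * L ^ 2 * B₃ ^ 2 * (1 + β₀) * γ ^ 2 < 1/10) :
    4 * B₃ * A₁ / A₀ + 30 * d ^ 2 * L ^ 2 * B₃ ^ 2 * (1 + β₀) * Real.exp (-(R : ℝ)) < 1/10 := by
  have h1 : Real.exp (-(R : ℝ)) ≤ γ ^ 2 := exp_neg_R_le_gamma_sq hr hRj hg hgγ hγe
  have hK : 0 ≤ 30 * d ^ 2 * L ^ 2 * B₃ ^ 2 * (1 + β₀) := by positivity
  have h2 := mul_le_mul_of_nonneg_left h1 hK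
  linarith

/-- **(3.7), THE CONCLUSION USED, FROM (190) AND γ**: as `ineq37_lt_of_ineq190` with `R = R_k` a natural number as in
(2.5) and the restriction `h10` replaced by the γ-data of `h10_of_gamma`.
[cite: Balaban1988Convergent, (3.7) p.266, (2.5) p.255] -/
theorem ineq37_lt_of_ineq190_gamma {T : Type*} {bB : BlockNorm g FB} {bout : BlockNorm g FA}
    {dH : T → FB →ₗ[ℝ] FA} {C δ₀ σ τ c D B₃ δ M₂ δk d L β₀ εk A₀ A₁ γ gk : ℝ} {Lnat r R : ℕ}
    (h190 : ∀ t, Ineq190 bB bout (dH t) C δ₀) (hC : 0 ≤ C) (hd : ∀ a b : g.Site, 0 ≤ g.dist a b)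
    (hrow : RowSum g σ c) (hτ : 0 ≤ τ) (hστ : σ + τ ≤ δ₀ / 8) {B₁ B₂ : FB} (y : g.Site)
    (hm₁ : ∀ y', bB.loc y' B₁ ≤ 4 * δk)
    (hm₂ : ∀ y', bB.loc y' B₂ ≤ 30 * d ^ 2 * L ^ 2 * B₃ * (1 + β₀) * εk)
    (hD₂ : ∀ y', bB.loc y' B₂ ≠ 0 → D ≤ g.dist y y')
    {HB : FA} (hmv : ∀ s : ℝ, (∀ t, bout.loc y (dH t (B₁ + B₂)) ≤ s) → bout.loc y HB ≤ s)
    (hgeom : 2 * δ * M₂ * R ≤ τ * D) (hCB : C * bB.κ * c ≤ B₃) (hB₃ : 0 ≤ B₃)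
    (hε : 0 < εk) (hβ : 0 ≤ 1 + β₀) (hδkε : δk = A₁ / A₀ * εk) (hM : 1 ≤ 2 * δ * M₂)
    (hr : 1 ≤ r) (hRj : B14.IsRj Lnat r gk R) (hg : 0 < gk) (hgγ : gk ≤ γ) (hγe : 1 ≤ Real.log (γ ^ 2)⁻¹)
    (hγ : 4 * B₃ * A₁ / A₀ + 30 * d ^ 2 * L ^ 2 * B₃ ^ 2 * (1 + β₀) * γ ^ 2 < 1/10) :
    bout.loc y HB < (1/10) * εk :=
  ineq37_lt_of_ineq190 h190 hC hd hrow hτ hστ y hm₁ hm₂ hD₂ hmv hgeom hCB hB₃ hε hβ hδkε hM (Nat.cast_nonneg R)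
    (h10_of_gamma hr hRj hg hgγ hγe hβ hγ)

/-! ## §3 [III] (3.8) end-to-end on the lattice model: "Thus χ_k(□) = 1" with no `𝐇`-hypothesis left -/

/-- **(3.8) ⇒ "Thus χ_k(□) = 1 for □⊂Ω~_{k+1}", ON THE LATTICE MODEL, FROM [15] (190)**
(`B14Ineq38Proof.ineq38_lt ∘ ineq37_lt_of_ineq190`, twice: function size `bout₀` and covariant-derivative size `bout₁`).
For p29's lattice expression `U_{k,□} = (e^{iη𝐇}U_{k+1,□′})^{u⁻¹}` ((3.6): `U₀ = U_{k+1,□′}`, `H = 𝐇_{k,□}(…)`, `u = u_{k,□}`) at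
the plaquette `p = (x; μ, ν)`: `|U_{k,□}(∂p) − 1| < ε_kη²`, the six `𝐇`-inputs DERIVED from (190) for the two sizes at the
base point `y`, the two-piece argument field (bulk `≤ 4δ_k`, layer `≤ 30d²L²B₃(1+β₀)ε_k` beyond distance `D`, `δ2M₂R_k ≤ τD`),
`Cκ_Bc ≤ B₃`, mean-value domination, r11's scalar data of (3.7) (`δ_k = (A₁/A₀)ε_k`, `2δM₂ ≥ 1`, `R_k ≥ 0`, `h10`), the
DICTIONARY (`hdom₁…₄`, `hdomD₁,₂`) and p29's located inputs verbatim.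
[cite: Balaban1988Convergent, (3.8) p.266; Balaban1985Variational, (190) p.308] -/
theorem ineq38_lt_lattice_of_ineq190
    -- [15]'s block-majorant data, two sizes
    {gB : B6.Geometry} {T : Type*} {bB : BlockNorm gB FB} {bout₀ bout₁ : BlockNorm gB FA} {dH : T → FB →ₗ[ℝ] FA}
    {C δ₀ σ τ c D B₃ δ M₂ R δk β₀ A₀ A₁ : ℝ}
    (h190₀ : ∀ t, Ineq190 bB bout₀ (dH t) C δ₀) (h190₁ : ∀ t, Ineq190 bB bout₁ (dH t) C δ₀) (hC : 0 ≤ C)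
    (hd : ∀ a b : gB.Site, 0 ≤ gB.dist a b) (hrow : RowSum gB σ c) (hτ : 0 ≤ τ) (hστ : σ + τ ≤ δ₀ / 8)
    {B₁ B₂ : FB} (y : gB.Site)
    -- the lattice data (p29)
    {d : ℕ} {𝔸 : Type*} [CStarAlgebra 𝔸] [Nontrivial 𝔸]
    {η : ℝ} (hη : 0 < η) (hη1 : η ≤ 1) {U₀ : B7Prop1Explicit.Site d → Fin d → 𝔸ˣ} (h₀ : ∀ z κ, U₀ z κ ∈ U1 𝔸)
    {H : B7Prop1Explicit.Site d → Fin d → 𝔸} (hH : ∀ z κ, IsSelfAdjoint (H z κ))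
    {u : B7Prop1Explicit.Site d → 𝔸ˣ} (hu : ∀ z, u z ∈ U1 𝔸) (μ ν : Fin d) (x : B7Prop1Explicit.Site d)
    {εk εk1 L : ℝ}
    -- the two pieces of the argument field and the geometry
    (hm₁ : ∀ y', bB.loc y' B₁ ≤ 4 * δk)
    (hm₂ : ∀ y', bB.loc y' B₂ ≤ 30 * (d : ℝ) ^ 2 * L ^ 2 * B₃ * (1 + β₀) * εk)
    (hD₂ : ∀ y', bB.loc y' B₂ ≠ 0 → D ≤ gB.dist y y')
    {HB : FA} (hmv₀ : ∀ s : ℝ, (∀ t, bout₀.loc y (dH t (B₁ + B₂)) ≤ s) → bout₀.loc y HB ≤ s)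
    (hmv₁ : ∀ s : ℝ, (∀ t, bout₁.loc y (dH t (B₁ + B₂)) ≤ s) → bout₁.loc y HB ≤ s)
    (hgeom : 2 * δ * M₂ * R ≤ τ * D) (hCB : C * bB.κ * c ≤ B₃) (hB₃ : 0 ≤ B₃)
    -- r11's scalar data of (3.7)
    (hβ : 0 ≤ 1 + β₀) (hδkε : δk = A₁ / A₀ * εk) (hM : 1 ≤ 2 * δ * M₂) (hR : 0 ≤ R)
    (h10 : 4 * B₃ * A₁ / A₀ + 30 * (d : ℝ) ^ 2 * L ^ 2 * B₃ ^ 2 * (1 + β₀) * Real.exp (-R) < 1/10)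
    -- the dictionary
    (hdom₁ : ‖H x μ‖ ≤ bout₀.loc y HB) (hdom₂ : ‖H (x + e μ) ν‖ ≤ bout₀.loc y HB)
    (hdom₃ : ‖H (x + e ν) μ‖ ≤ bout₀.loc y HB) (hdom₄ : ‖H x ν‖ ≤ bout₀.loc y HB)
    (hdomD₁ : ‖B8Ineq132.covDerivFwd η U₀ μ (fun z => H z ν) x‖ ≤ bout₁.loc y HB)
    (hdomD₂ : ‖B8Ineq132.covDerivFwd η U₀ ν (fun z => H z μ) x‖ ≤ bout₁.loc y HB)
    -- p29's located inputs
    (hε : 0 < εk) (hε1 : εk ≤ 1) (hL : 0 < L) (hε' : 0 < εk1) (hflow : εk1 ≤ (1 + β₀) * εk)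
    (hrestr : 2 * (1 + β₀) * L⁻¹ ^ 2 + 4/10 < 1)
    (hdev₀ : ‖B8Ineq132.plaqF U₀ μ ν x - 1‖ < εk1 * (L⁻¹ * η) ^ 2) :
    ‖B8Ineq132.plaqF (gaugeAct u (B8Lemma1NonAbelian.mulCfg (B8Eq146AExpansion.expCfg
        (B8Eq146AExpansion.iEta η H)) U₀)) μ ν x - 1‖ < εk * η ^ 2 := by
  have hb₀ := ineq37_lt_of_ineq190 h190₀ hC hd hrow hτ hστ y hm₁ hm₂ hD₂ hmv₀ hgeom hCB hB₃ hε hβ hδkε hM hR h10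
  have hb₁ := ineq37_lt_of_ineq190 h190₁ hC hd hrow hτ hστ y hm₁ hm₂ hD₂ hmv₁ hgeom hCB hB₃ hε hβ hδkε hM hR h10
  have hb₀' : bout₀.loc y HB ≤ εk / 10 := by linarith
  have hb₁' : bout₁.loc y HB ≤ εk / 10 := by linarith
  exact ineq38_lt hη hη1 h₀ hH hu μ ν x hε hε1 hL hε' hflow hrestr hdev₀ (hdom₁.trans hb₀') (hdom₂.trans hb₀')
    (hdom₃.trans hb₀') (hdom₄.trans hb₀') (hdomD₁.trans hb₁') (hdomD₂.trans hb₁')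

/-- **(3.8) ⇒ "Thus χ_k(□) = 1", ON THE LATTICE MODEL, FROM [15] (190) AND γ**: as `ineq38_lt_lattice_of_ineq190` with
`R = R_k` a natural number as in (2.5) (`B14.IsRj`, `r ≥ 1`), `0 < g_k ≤ γ`, `log γ⁻² ≥ 1`, and the restriction `h10`
replaced by the explicit clause `4B₃A₁/A₀ + 30d²L²B₃²(1+β₀)γ² < 1/10` (`h10_of_gamma`).
[cite: Balaban1988Convergent, (3.8) p.266, (2.5) p.255] -/
theorem ineq38_lt_lattice_of_ineq190_gamma
    {gB : B6.Geometry} {T : Type*} {bB : BlockNorm gB FB} {bout₀ bout₁ : BlockNorm gB FA} {dH : T → FB →ₗ[ℝ] FA}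
    {C δ₀ σ τ c D B₃ δ M₂ δk β₀ A₀ A₁ γ gk : ℝ} {Lnat r R : ℕ}
    (h190₀ : ∀ t, Ineq190 bB bout₀ (dH t) C δ₀) (h190₁ : ∀ t, Ineq190 bB bout₁ (dH t) C δ₀) (hC : 0 ≤ C)
    (hd : ∀ a b : gB.Site, 0 ≤ gB.dist a b) (hrow : RowSum gB σ c) (hτ : 0 ≤ τ) (hστ : σ + τ ≤ δ₀ / 8)
    {B₁ B₂ : FB} (y : gB.Site)
    {d : ℕ} {𝔸 : Type*} [CStarAlgebra 𝔸] [Nontrivial 𝔸]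
    {η : ℝ} (hη : 0 < η) (hη1 : η ≤ 1) {U₀ : B7Prop1Explicit.Site d → Fin d → 𝔸ˣ} (h₀ : ∀ z κ, U₀ z κ ∈ U1 𝔸)
    {H : B7Prop1Explicit.Site d → Fin d → 𝔸} (hH : ∀ z κ, IsSelfAdjoint (H z κ))
    {u : B7Prop1Explicit.Site d → 𝔸ˣ} (hu : ∀ z, u z ∈ U1 𝔸) (μ ν : Fin d) (x : B7Prop1Explicit.Site d)
    {εk εk1 L : ℝ}
    (hm₁ : ∀ y', bB.loc y' B₁ ≤ 4 * δk)
    (hm₂ : ∀ y', bB.loc y' B₂ ≤ 30 * (d : ℝ) ^ 2 * L ^ 2 * B₃ * (1 + β₀) * εk)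
    (hD₂ : ∀ y', bB.loc y' B₂ ≠ 0 → D ≤ gB.dist y y')
    {HB : FA} (hmv₀ : ∀ s : ℝ, (∀ t, bout₀.loc y (dH t (B₁ + B₂)) ≤ s) → bout₀.loc y HB ≤ s)
    (hmv₁ : ∀ s : ℝ, (∀ t, bout₁.loc y (dH t (B₁ + B₂)) ≤ s) → bout₁.loc y HB ≤ s)
    (hgeom : 2 * δ * M₂ * R ≤ τ * D) (hCB : C * bB.κ * c ≤ B₃) (hB₃ : 0 ≤ B₃)
    (hβ : 0 ≤ 1 + β₀) (hδkε : δk = A₁ / A₀ * εk) (hM : 1 ≤ 2 * δ * M₂)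
    (hr : 1 ≤ r) (hRj : B14.IsRj Lnat r gk R) (hg : 0 < gk) (hgγ : gk ≤ γ) (hγe : 1 ≤ Real.log (γ ^ 2)⁻¹)
    (hγ : 4 * B₃ * A₁ / A₀ + 30 * (d : ℝ) ^ 2 * L ^ 2 * B₃ ^ 2 * (1 + β₀) * γ ^ 2 < 1/10)
    (hdom₁ : ‖H x μ‖ ≤ bout₀.loc y HB) (hdom₂ : ‖H (x + e μ) ν‖ ≤ bout₀.loc y HB)
    (hdom₃ : ‖H (x + e ν) μ‖ ≤ bout₀.loc y HB) (hdom₄ : ‖H x ν‖ ≤ bout₀.loc y HB)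
    (hdomD₁ : ‖B8Ineq132.covDerivFwd η U₀ μ (fun z => H z ν) x‖ ≤ bout₁.loc y HB)
    (hdomD₂ : ‖B8Ineq132.covDerivFwd η U₀ ν (fun z => H z μ) x‖ ≤ bout₁.loc y HB)
    (hε : 0 < εk) (hε1 : εk ≤ 1) (hL : 0 < L) (hε' : 0 < εk1) (hflow : εk1 ≤ (1 + β₀) * εk)
    (hrestr : 2 * (1 + β₀) * L⁻¹ ^ 2 + 4/10 < 1)
    (hdev₀ : ‖B8Ineq132.plaqF U₀ μ ν x - 1‖ < εk1 * (L⁻¹ * η) ^ 2) :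
    ‖B8Ineq132.plaqF (gaugeAct u (B8Lemma1NonAbelian.mulCfg (B8Eq146AExpansion.expCfg
        (B8Eq146AExpansion.iEta η H)) U₀)) μ ν x - 1‖ < εk * η ^ 2 :=
  ineq38_lt_lattice_of_ineq190 h190₀ h190₁ hC hd hrow hτ hστ y hη hη1 h₀ hH hu μ ν x hm₁ hm₂ hD₂ hmv₀ hmv₁ hgeom hCB
    hB₃ hβ hδkε hM (Nat.cast_nonneg R) (h10_of_gamma hr hRj hg hgγ hγe hβ hγ) hdom₁ hdom₂ hdom₃ hdom₄ hdomD₁ hdomD₂ hε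
    hε1 hL hε' hflow hrestr hdev₀

/-! ## §4 (v1.1) [III] (2.8) BY NAME — the flow letter `ε_{k+1} ≤ (1+β₀)ε_k` of §3 from r11's typed row B14.Eq2.8

(3.8) p. 266: *"|U_{k,□}(∂p) − 1| < (1 + (2/10)ε_kη)ε_{k+1}(L⁻¹η)² + (2/10)ε_kη²(1 + (4/10)ε_k) < 2(1+β₀)L⁻²ε_kη² +
(4/10)ε_kη² < ε_kη²"* — the middle `<` uses the first member of (2.8) p. 256 *"ε_n ≦ (1+β₀)(n−m)^{1/2}ε_m"* at ONE step
`(m, n) = (k, k+1)` (`(n−m)^{1/2} = 1`).  §3 carries it as the letter `hflow`; here it is taken BY NAME from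
`B14.FlowIneq28 ε g β′ β₀ K` (`B14.lean`, row B14.Eq2.8), as §3 of `B14Ineq319From190` (gen 94) and `B14Eq322From190` v1.1
(gen 95) do for (3.18)/(3.19)/p. 269 — the first member is the SIGN-FREE one in β (a theorem of the tree along any RG flow
of (I.0.20) given β ≤ β′ and γ-smallness, `B14FlowStep.flowIneq28a_signfree`).  Theorems only; §§1–3 untouched. -/

/-- **(3.8) ⇒ "Thus χ_k(□) = 1", ON THE LATTICE MODEL, FROM [15] (190) AND γ, WITH (2.5) AND (2.8) BY NAME**: §3's
`ineq38_lt_lattice_of_ineq190_gamma` with its one-step flow letter `hflow : ε_{k+1} ≤ (1+β₀)ε_k` DERIVED from r11's typed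
(2.8) `B14.FlowIneq28 ε g β′ β₀ K` at the step `k → k+1 ≤ K` (first member, `((k+1)−k)^{1/2} = 1`); the sequences `ε`, `g`
are those of the inductive description ((2.4)–(2.8)), read at `k` and `k+1` (`ε_k`, `ε_{k+1}`, `g_k`); (2.5) by name as in
§3 (`hRj : B14.IsRj L r g_k R_k`).  Every other hypothesis verbatim from §3.
[cite: Balaban1988Convergent, (3.8) p.266, (2.8) p.256, (2.5) p.255; Balaban1985Variational, (190) p.308] -/
theorem ineq38_lt_lattice_of_ineq190_gamma_byname
    {gB : B6.Geometry} {T : Type*} {bB : BlockNorm gB FB} {bout₀ bout₁ : BlockNorm gB FA} {dH : T → FB →ₗ[ℝ] FA}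
    {C δ₀ σ τ c D B₃ δ M₂ δk β₀ β' A₀ A₁ γ : ℝ} {Lnat r R K k : ℕ} {ε gseq : ℕ → ℝ}
    (h190₀ : ∀ t, Ineq190 bB bout₀ (dH t) C δ₀) (h190₁ : ∀ t, Ineq190 bB bout₁ (dH t) C δ₀) (hC : 0 ≤ C)
    (hd : ∀ a b : gB.Site, 0 ≤ gB.dist a b) (hrow : RowSum gB σ c) (hτ : 0 ≤ τ) (hστ : σ + τ ≤ δ₀ / 8)
    {B₁ B₂ : FB} (y : gB.Site)
    {d : ℕ} {𝔸 : Type*} [CStarAlgebra 𝔸] [Nontrivial 𝔸]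
    {η : ℝ} (hη : 0 < η) (hη1 : η ≤ 1) {U₀ : B7Prop1Explicit.Site d → Fin d → 𝔸ˣ} (h₀ : ∀ z κ, U₀ z κ ∈ U1 𝔸)
    {H : B7Prop1Explicit.Site d → Fin d → 𝔸} (hH : ∀ z κ, IsSelfAdjoint (H z κ))
    {u : B7Prop1Explicit.Site d → 𝔸ˣ} (hu : ∀ z, u z ∈ U1 𝔸) (μ ν : Fin d) (x : B7Prop1Explicit.Site d)
    {L : ℝ}
    (hm₁ : ∀ y', bB.loc y' B₁ ≤ 4 * δk)
    (hm₂ : ∀ y', bB.loc y' B₂ ≤ 30 * (d : ℝ) ^ 2 * L ^ 2 * B₃ * (1 + β₀) * ε k)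
    (hD₂ : ∀ y', bB.loc y' B₂ ≠ 0 → D ≤ gB.dist y y')
    {HB : FA} (hmv₀ : ∀ s : ℝ, (∀ t, bout₀.loc y (dH t (B₁ + B₂)) ≤ s) → bout₀.loc y HB ≤ s)
    (hmv₁ : ∀ s : ℝ, (∀ t, bout₁.loc y (dH t (B₁ + B₂)) ≤ s) → bout₁.loc y HB ≤ s)
    (hgeom : 2 * δ * M₂ * R ≤ τ * D) (hCB : C * bB.κ * c ≤ B₃) (hB₃ : 0 ≤ B₃)
    (hβ : 0 ≤ 1 + β₀) (hδkε : δk = A₁ / A₀ * ε k) (hM : 1 ≤ 2 * δ * M₂)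
    -- (2.5) BY NAME and the γ data
    (hr : 1 ≤ r) (hRj : B14.IsRj Lnat r (gseq k) R) (hg : 0 < gseq k) (hgγ : gseq k ≤ γ) (hγe : 1 ≤ Real.log (γ ^ 2)⁻¹)
    (hγ : 4 * B₃ * A₁ / A₀ + 30 * (d : ℝ) ^ 2 * L ^ 2 * B₃ ^ 2 * (1 + β₀) * γ ^ 2 < 1/10)
    (hdom₁ : ‖H x μ‖ ≤ bout₀.loc y HB) (hdom₂ : ‖H (x + e μ) ν‖ ≤ bout₀.loc y HB)
    (hdom₃ : ‖H (x + e ν) μ‖ ≤ bout₀.loc y HB) (hdom₄ : ‖H x ν‖ ≤ bout₀.loc y HB)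
    (hdomD₁ : ‖B8Ineq132.covDerivFwd η U₀ μ (fun z => H z ν) x‖ ≤ bout₁.loc y HB)
    (hdomD₂ : ‖B8Ineq132.covDerivFwd η U₀ ν (fun z => H z μ) x‖ ≤ bout₁.loc y HB)
    (hε : 0 < ε k) (hε1 : ε k ≤ 1) (hL : 0 < L) (hε' : 0 < ε (k + 1))
    -- (2.8) BY NAME at the step k → k+1 ≤ K
    (h28 : B14.FlowIneq28 ε gseq β' β₀ K) (hk : k + 1 ≤ K)
    (hrestr : 2 * (1 + β₀) * L⁻¹ ^ 2 + 4/10 < 1)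
    (hdev₀ : ‖B8Ineq132.plaqF U₀ μ ν x - 1‖ < ε (k + 1) * (L⁻¹ * η) ^ 2) :
    ‖B8Ineq132.plaqF (gaugeAct u (B8Lemma1NonAbelian.mulCfg (B8Eq146AExpansion.expCfg
        (B8Eq146AExpansion.iEta η H)) U₀)) μ ν x - 1‖ < ε k * η ^ 2 := by
  -- the first member of (2.8) at (m, n) = (k, k+1): ε_{k+1} ≤ (1+β₀)·√1·ε_k
  have hflow : ε (k + 1) ≤ (1 + β₀) * ε k := by
    obtain ⟨h, -⟩ := h28 k (k + 1) (Nat.lt_succ_self k) hk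
    have e1 : (((k + 1 : ℕ) : ℝ) - (k : ℕ)) = 1 := by push_cast; ring
    rw [e1, Real.sqrt_one, mul_one] at h
    exact h
  exact ineq38_lt_lattice_of_ineq190_gamma h190₀ h190₁ hC hd hrow hτ hστ y hη hη1 h₀ hH hu μ ν x hm₁ hm₂ hD₂ hmv₀ hmv₁
    hgeom hCB hB₃ hβ hδkε hM hr hRj hg hgγ hγe hγ hdom₁ hdom₂ hdom₃ hdom₄ hdomD₁ hdomD₂ hε hε1 hL hε' hflow hrestr hdev₀

end Literature.MathematicalPhysics.QuantumFieldTheory.Balaban1983to89.B14Ineq38From190
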